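import Mathlib.Data.Real.Basic
import Mathlib.Tactic.Linarith
import Mathlib.Tactic.Ring
import Summits.CriticalPhenomena.PercolationContinuityZ3.Theorems.PercNearOneGluingNoHeavyLowerTailThreePointLBSwitchingCertificate
import HarnessLib

/-!
# `NoHeavyLowerTail` (stmt-CriticalPhenomena-4575) — Γ ≥ 0 (the Aas–Gladkov inequality sharpened by its star and triangle defects) by two
# switchings, I: the finite certificate check (13 atoms, 10 implications) and the identity

Support file (prover prim-cert-2 gen 9; `--supports stmt-CriticalPhenomena-4575`).  No named facts, no sorries; graph-free.

The two finite ingredients of prim-lit-2's PROOF-GAMMA.md (2026-08-19; Γ = ineq-gen-2's sharpened AG, HMAX-SPLIT.md) that do not mention graphs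
(companion of `…ThreePointLBSwitchingCertificate`, whose `pind`/`bI` it reuses):
* `gamcertB_nonpos` / `gamcertP_nonpos` — **Lemma 2 (pointwise), abstract form.**  After the sealed-island facts rewrite the memberships of the outputs
  `o₂ = X_{E(A)}Y`, `o₃′ = X_{E(B)}Z` of the two switchings `Φ₃, Φ₄`, the pointwise sum `S = λ₃∘Φ₃ + λ₄∘Φ₄` is a signed sum of six indicator monomials in
  THIRTEEN atoms: `xab, xac, xbc` (connections in `X`), `yA = [b ~ c by Y-pairs avoiding A]`, `zB = [a ~ c by Z-pairs avoiding B]`, `sD = [b ~ c by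
  SUPPORT pairs avoiding A]` (the negation of the separation flag), `m3ab, m3ac, m3bc` (connections in the two-region output `o₃` of `Φ₃`), `m4ab, m4ac, m4bc`
  (in the two-region output `o₂′` of `Φ₄`) and `piv4 = [b ~ c in o₂′ with the pairs at a closed]` (negation of "`a` pivotal in `o₂′`"); the cluster facts
  supply TEN implications.  `gamcertB_nonpos`: on all `2¹³` Boolean patterns satisfying them the sum is `≤ 0` (`decide`); `gamcertP_nonpos`: for
  propositions.  (Machine cross-check of the abstraction: prim-cert-2 work/gam/abstract2.py, max 0; the ten implications are a minimal sufficient set.)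
* `gamma_identity` — **IDENTITY (E)**: the sum of the six expectations equals `−Γ = −(q t − u_au_b − u_au_c − u_bu_c − u_a(n + n′))` (`ring`).
-/

noncomputable section

namespace Summit.CriticalPhenomena.PercolationContinuityZ3.Theorems

namespace ThreePointGamma

open ThreePointLB

/-! ### The finite certificate check -/

/-- The pointwise Γ-certificate as a function of the 13 Boolean atoms (parenthesised as `simp` produces it). [this work] -/
def gamcertB (xab xac xbc yA zB sD m3ab m3ac m3bc m4ab m4ac m4bc piv4 : Bool) : ℤ :=
  - bI ((!xab && (!xac && !((xab && xac) || (!xab && yA)))) && m3ac)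
  - bI (((!xab && (!xac && !((xab && xac) || (!xab && yA)))) && sD) && (m3bc && !m3ab))
  + bI ((m4ac && !m4ab) && (xbc && !xab))
  + bI ((!m4ac && !m4bc) && (xbc && !xab))
  + bI ((!m4ac && !m4bc) && (((xab && xbc) || (!xab && zB)) && !xab))
  + bI (((m4ab && m4ac) && !piv4) && (xbc && !xab))

set_option synthInstance.maxHeartbeats 200000 in
set_option synthInstance.maxSize 2048 in
/-- **The Γ-certificate is pointwise nonpositive** on every Boolean pattern compatible with the ten implications (`2¹³` cases, `decide`). [this work] -/
theorem gamcertB_nonpos : ∀ xab xac xbc yA zB sD m3ab m3ac m3bc m4ab m4ac m4bc piv4 : Bool,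
    (xac = true → xbc = true → xab = true) → (m3ab = true → m3bc = true → m3ac = true) →
    (m4ac = true → m4bc = true → m4ab = true) → (xab = false → xbc = true → m3bc = true) →
    (zB = true → m3ac = true) → (xab = false → xac = true → m4ac = true) →
    (yA = true → m4bc = true) → (yA = true → piv4 = true) →
    (xab = false → xbc = true → sD = true) → (xab = false → zB = true → xbc = false) →
    gamcertB xab xac xbc yA zB sD m3ab m3ac m3bc m4ab m4ac m4bc piv4 ≤ 0 := by
  decide +kernel

/-- **Pointwise lemma, propositional form** (PROOF-GAMMA, Lemma 2 with the cluster facts abstracted). [this work] -/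
theorem gamcertP_nonpos (xab xac xbc yA zB sD m3ab m3ac m3bc m4ab m4ac m4bc piv4 : Prop)
    (h1 : xac → xbc → xab) (h2 : m3ab → m3bc → m3ac) (h3 : m4ac → m4bc → m4ab) (h4 : ¬xab → xbc → m3bc) (h5 : zB → m3ac)
    (h6 : ¬xab → xac → m4ac) (h7 : yA → m4bc) (h8 : yA → piv4) (h9 : ¬xab → xbc → sD) (h10 : ¬xab → zB → ¬xbc) :
    -pind ((¬xab ∧ ¬xac ∧ ¬(xab ∧ xac ∨ ¬xab ∧ yA)) ∧ m3ac)
    - pind (((¬xab ∧ ¬xac ∧ ¬(xab ∧ xac ∨ ¬xab ∧ yA)) ∧ sD) ∧ m3bc ∧ ¬m3ab)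
    + pind ((m4ac ∧ ¬m4ab) ∧ xbc ∧ ¬xab)
    + pind ((¬m4ac ∧ ¬m4bc) ∧ xbc ∧ ¬xab)
    + pind ((¬m4ac ∧ ¬m4bc) ∧ (xab ∧ xbc ∨ ¬xab ∧ zB) ∧ ¬xab)
    + pind (((m4ab ∧ m4ac) ∧ ¬piv4) ∧ xbc ∧ ¬xab) ≤ 0 := by
  classical
  have key := gamcertB_nonpos (decide xab) (decide xac) (decide xbc) (decide yA) (decide zB) (decide sD) (decide m3ab) (decide m3ac)
      (decide m3bc) (decide m4ab) (decide m4ac) (decide m4bc) (decide piv4)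
      (by simpa only [decide_eq_true_eq] using h1) (by simpa only [decide_eq_true_eq] using h2)
      (by simpa only [decide_eq_true_eq] using h3) (by simpa only [decide_eq_true_eq, decide_eq_false_iff_not] using h4)
      (by simpa only [decide_eq_true_eq] using h5) (by simpa only [decide_eq_true_eq, decide_eq_false_iff_not] using h6)
      (by simpa only [decide_eq_true_eq] using h7) (by simpa only [decide_eq_true_eq] using h8)
      (by simpa only [decide_eq_true_eq, decide_eq_false_iff_not] using h9)
      (by simpa only [decide_eq_true_eq, decide_eq_false_iff_not] using h10)
  rw [pind_eq_bI, pind_eq_bI, pind_eq_bI, pind_eq_bI, pind_eq_bI, pind_eq_bI]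
  simp only [Bool.decide_and, Bool.decide_or, decide_not]
  unfold gamcertB at key
  exact_mod_cast key

/-! ### The identity -/

/-- **IDENTITY (E)** of PROOF-GAMMA: `E[λ₃] + E[λ₄] = −Γ`, as a polynomial identity in the cell masses `q, u_a, u_b, u_c, t` and the refined masses
`n = P(abc ∧ a pivotal)`, `n′ = P(a|b|c ∧ separating)`: with `P(a~c) = u_b + t`, `P(Q ∖ Qsa) = q − n′`, `P(c ≁ a, c ≁ b) = q + u_c`. [this work] -/
theorem gamma_identity (q ua ub uc t n n' : ℝ) :
    -(1 * q * (ub + t)) - 1 * (q - n') * ua + 1 * ub * ua + 1 * (q + uc) * ua + 1 * (q + uc) * ub + 1 * n * ua =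
      -(q * t - ua * ub - ua * uc - ub * uc - ua * (n + n')) := by
  ring

end ThreePointGamma

end Summit.CriticalPhenomena.PercolationContinuityZ3.Theorems

end
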